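import Summits.ValiantsHypothesis.ValiantsHypothesis.Theorems.LacunarySymmetroidMatrixDescartesFiniteSector

/-!
# `MatrixDescartes` — line «finite» / «stamp»: the STAMP CEILING of the `m = 2` row in closed form,
# `ν(2,K) ≤ n(2,K−1)` for `K ≤ 6` (kernel): `ν(2,4) ≤ 8`, `ν(2,5) ≤ 12`, `ν(2,6) ≤ 16` — hence `ν(2,3) = 4`, `ν(2,4) = 8`,
# `ν(2,5) = 12` EXACT on both sides, and the open target `G6` asks exactly whether the `K = 6` ceiling `16` is attained

HONEST FRAMING.  Object-search cell `pub-symmetroid`, seat val-sym-door-p5 g7.  HELPER of the crux item `stmt-ValiantsHypothesis-18050`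
(`Theses.LacunarySymmetroid.MatrixDescartes`, asymptotic in `K`) with NO closure claim.  The PROVED postage-stamp ceiling T3 of line «finite»
(`…FiniteSector.mem_sumset_of_fullPos`, val-idea-6 g3 / port eng-3 g3) says: a full-positive-rooted symmetric `(m,K)` half-pencil determinant of
degree `n` has `[0,n]` inside the `m`-fold sumset of its `K` exponents.  The `K = 3` COLUMN was turned into numeric rows by val-sym-eng-3 g4
(`…FiniteSectorStampCeilingKThree`: `ν(m,3) ≤ n(m,2)`, `m ≤ 7`).  This file does the same for the `m = 2` ROW: with two stamps the sumset is the set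
of PAIR SUMS `dᵢ + dⱼ`; covering `[0, N+1]` forces the values `0` and `1` among the exponents, and a finite check over the remaining `K − 2` capped
values (`(K−2)`-subsets of `[0, N+2]`, `decide` in the kernel) shows that `[0, n(2,K−1)+1]` is never covered: `StampLawAt 2 4 8`, `StampLawAt 2 5 12`,
`StampLawAt 2 6 16` (classical two-stamp postage numbers `n(2,3) = 8`, `n(2,4) = 12`, `n(2,5) = 16`; OEIS A001212).  With the kernel witnesses
`fullyRealisable_two_013_4` (…StampFull013), `fullyRealisable_two_0134_8` (…StampFull0134, both val-sym-door-p5 g7) and `fullyRealisable_two_01356_12`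
(…StampFull01356, val-sym-engine-7) and eng-3's `stampLawAt_two_three`, the `m = 2` stamp row is EXACT ON BOTH SIDES in the kernel for `K = 3, 4, 5`
(`ν = 4, 8, 12`), and for `K = 6` the ceiling is `16` — the degree of the OPEN search target `G6 = FullyRealisable 2 dA5 16` of line «stamp»
(nothing is claimed about `G6` here).  Nothing in this file bears on the crux, on the doors, or on `VP ≠ VNP`.
[folklore] Postage-stamp (two stamps, `K − 1` denominations) bookkeeping; no citation is load-bearing.
-/

-- `Summit.ValiantsHypothesis.ValiantsHypothesis.…` repeats a component by the D-0017 layout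
-- (single-conjunct summit), which the `dupNamespace` linter flags; the name is mandated.
set_option linter.dupNamespace false

namespace Summit.ValiantsHypothesis.ValiantsHypothesis.Theorems.LacunarySymmetroidMatrixDescartes.FiniteSector

open scoped BigOperators Matrix
open Polynomial

/-! ## §1 From a finite pair-sum check to the `m = 2` stamp ceiling -/

/-- **`m = 2` stamp ceiling, abstract form.**  Suppose that for every set `W ⊆ [0, N+2]` of exactly `K − 2` further values the pair sums of
`{0, 1} ∪ W` miss some `r ≤ N + 1` (`2 ≤ K ≤ N + 5`).  Then every full-positive-rooted symmetric `(2,K)` half-pencil determinant has degree `≤ N`: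
`StampLawAt 2 K N`.  (T3 `mem_sumset_of_fullPos`: every `r ≤ deg` is a pair sum `dᵢ + dⱼ`; `r = 0, 1` force the values `0, 1`; exponents are
capped at `N + 2` without changing which `r ≤ N + 1` are pair sums; a smaller value set is padded to `K − 2` elements, which only adds pair
sums.) [folklore] -/
theorem stampLawAt_two_of_pairCheck {K N : ℕ} (hK : 2 ≤ K) (hKN : K ≤ N + 5)
    (h : ∀ W ∈ (Finset.range (N + 3)).powersetCard (K - 2),
      ∃ r ∈ Finset.range (N + 2), ∀ u ∈ insert 0 (insert 1 W), ∀ v ∈ insert 0 (insert 1 W), u + v ≠ r) :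
    StampLawAt 2 K N := by
  intro d S hS hfull
  by_contra hdeg'
  have hdeg : N < (pencil d S).det.natDegree := not_le.mp hdeg'
  have hq : (pencil d S).det ≠ 0 := by
    intro h0
    rw [h0] at hdeg
    simp at hdeg
  -- every r ≤ natDegree is a pair sum of exponents
  have hmem : ∀ r, r ≤ (pencil d S).det.natDegree → ∃ i j : Fin K, d i + d j = r := by
    intro r hr
    have hm := mem_sumset_of_fullPos d S hq hfull hr
    rw [Finset.mem_image] at hm
    obtain ⟨s, -, hs⟩ := hm
    have hcard2 : Multiset.card (s : Multiset (Fin K)) = 2 := s.2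
    obtain ⟨i, j, hij⟩ := Multiset.card_eq_two.mp hcard2
    refine ⟨i, j, ?_⟩
    have hsum : ((s : Multiset (Fin K)).map d).sum = d i + d j := by
      rw [hij]
      simp
    omega
  -- capped values
  set c : Fin K → ℕ := fun i => min (d i) (N + 2) with hc
  have hcd : ∀ i, d i ≤ N + 1 → c i = d i := fun i hi => by
    simp only [hc]
    exact Nat.min_eq_left (by omega)
  have hcle : ∀ i, c i ≤ N + 2 := fun i => Nat.min_le_right _ _
  have hcge : ∀ i, 2 ≤ d i → 2 ≤ c i := fun i hi => by
    simp only [hc]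
    rcases le_total (d i) (N + 2) with hle | hle
    · rw [Nat.min_eq_left hle]; exact hi
    · rw [Nat.min_eq_right hle]; omega
  set V : Finset ℕ := Finset.univ.image c with hV
  have hcV : ∀ i, c i ∈ V := fun i => Finset.mem_image_of_mem c (Finset.mem_univ i)
  have h0V : 0 ∈ V := by
    obtain ⟨i, j, hij⟩ := hmem 0 (Nat.zero_le _)
    have : c i = 0 := by rw [hcd i (by omega)]; omega
    exact this ▸ hcV i
  have h1V : 1 ∈ V := by
    obtain ⟨i, j, hij⟩ := hmem 1 (by omega)
    rcases Nat.eq_zero_or_pos (d i) with hi | hi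
    · have : c j = 1 := by rw [hcd j (by omega)]; omega
      exact this ▸ hcV j
    · have : c i = 1 := by rw [hcd i (by omega)]; omega
      exact this ▸ hcV i
  set W : Finset ℕ := (V.erase 0).erase 1 with hW
  have h1V' : 1 ∈ V.erase 0 := Finset.mem_erase.mpr ⟨by norm_num, h1V⟩
  have hVeq : insert 0 (insert 1 W) = V := by
    rw [hW, Finset.insert_erase h1V', Finset.insert_erase h0V]
  have hWsub : W ⊆ Finset.range (N + 3) := by
    intro u hu
    rw [hW, Finset.mem_erase, Finset.mem_erase] at hu
    obtain ⟨-, -, huV⟩ := hu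
    rw [hV, Finset.mem_image] at huV
    obtain ⟨i, -, rfl⟩ := huV
    rw [Finset.mem_range]
    exact Nat.lt_succ_of_le (hcle i)
  have hcard : W.card ≤ K - 2 := by
    have hVK : V.card ≤ K := by
      have := Finset.card_image_le (s := (Finset.univ : Finset (Fin K))) (f := c)
      simpa using this
    have h1 : (V.erase 0).card + 1 = V.card := Finset.card_erase_add_one h0V
    have h2 : W.card + 1 = (V.erase 0).card := by rw [hW]; exact Finset.card_erase_add_one h1V'
    omega
  -- pad W to exactly K - 2 values inside [0, N+2] (padding only ADDS pair sums)
  obtain ⟨W', hWW', hW'sub, hW'card⟩ := Finset.exists_subsuperset_card_eq hWsub hcard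
    (by rw [Finset.card_range]; omega)
  obtain ⟨r, hr, hne⟩ := h W' (Finset.mem_powersetCard.mpr ⟨hW'sub, hW'card⟩)
  rw [Finset.mem_range] at hr
  obtain ⟨i, j, hij⟩ := hmem r (by omega)
  have hci : c i = d i := hcd i (by omega)
  have hcj : c j = d j := hcd j (by omega)
  have hsubV : V ⊆ insert 0 (insert 1 W') := by
    rw [← hVeq]
    exact Finset.insert_subset_insert _ (Finset.insert_subset_insert _ hWW')
  exact hne (c i) (hsubV (hcV i)) (c j) (hsubV (hcV j)) (by rw [hci, hcj]; exact hij)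

/-! ## §2 The finite checks (two stamps, `K − 1` denominations): `n(2,3) = 8`, `n(2,4) = 12`, `n(2,5) = 16` -/

/-- No `W ⊆ [0,10]` with `|W| = 2` makes `{0,1} ∪ W` cover `[0,9]` by pair sums (`n(2,3) = 8`, attained by `{1,3,4}`). [folklore] -/
theorem pairCheck_two_four : ∀ W ∈ (Finset.range 11).powersetCard 2,
    ∃ r ∈ Finset.range 10, ∀ u ∈ insert 0 (insert 1 W), ∀ v ∈ insert 0 (insert 1 W), u + v ≠ r := by
  decide +kernel

/-- No `W ⊆ [0,14]` with `|W| = 3` makes `{0,1} ∪ W` cover `[0,13]` by pair sums (`n(2,4) = 12`, attained by `{1,3,5,6}`). [folklore] -/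
theorem pairCheck_two_five : ∀ W ∈ (Finset.range 15).powersetCard 3,
    ∃ r ∈ Finset.range 14, ∀ u ∈ insert 0 (insert 1 W), ∀ v ∈ insert 0 (insert 1 W), u + v ≠ r := by
  decide +kernel

/-- No `W ⊆ [0,18]` with `|W| = 4` makes `{0,1} ∪ W` cover `[0,17]` by pair sums (`n(2,5) = 16`, attained only by `{1,3,5,7,8}`). [folklore] -/
theorem pairCheck_two_six : ∀ W ∈ (Finset.range 19).powersetCard 4,
    ∃ r ∈ Finset.range 18, ∀ u ∈ insert 0 (insert 1 W), ∀ v ∈ insert 0 (insert 1 W), u + v ≠ r := by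
  decide +kernel

/-! ## §3 The numeric rows of the `m = 2` stamp register -/

/-- **`ν(2,4) ≤ 8 = n(2,3)`** — with `fullyRealisable_two_0134_8` (…StampFull0134): `ν(2,4) = 8` EXACT. [folklore] -/
theorem stampLawAt_two_four : StampLawAt 2 4 8 :=
  stampLawAt_two_of_pairCheck (by norm_num) (by norm_num) pairCheck_two_four

/-- **`ν(2,5) ≤ 12 = n(2,4)`** — with `fullyRealisable_two_01356_12` (…StampFull01356, val-sym-engine-7): `ν(2,5) = 12` EXACT. [folklore] -/
theorem stampLawAt_two_five : StampLawAt 2 5 12 :=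
  stampLawAt_two_of_pairCheck (by norm_num) (by norm_num) pairCheck_two_five

/-- **`ν(2,6) ≤ 16 = n(2,5)`** — the `K = 6` ceiling; whether it is ATTAINED is exactly the open search target `G6 = FullyRealisable 2 dA5 16`
of line «stamp» (the unique extremal basis `{1,3,5,7,8}`); nothing is claimed about `G6` here. [folklore] -/
theorem stampLawAt_two_six : StampLawAt 2 6 16 :=
  stampLawAt_two_of_pairCheck (by norm_num) (by norm_num) pairCheck_two_six

/-- The `m = 2` row in one line: every full-positive-rooted symmetric `2 × 2` half-pencil determinant with `K = 4, 5, 6` terms has degree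
`≤ 8, 12, 16` respectively. [folklore] -/
theorem stampCeiling_two_row : StampLawAt 2 4 8 ∧ StampLawAt 2 5 12 ∧ StampLawAt 2 6 16 :=
  ⟨stampLawAt_two_four, stampLawAt_two_five, stampLawAt_two_six⟩

end Summit.ValiantsHypothesis.ValiantsHypothesis.Theorems.LacunarySymmetroidMatrixDescartes.FiniteSector
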